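import Summits.BirchSwinnertonDyer.BirchSwinnertonDyer.Theorems.Rank2ObservatoryRank3CensusCurves9375
import Literature.NumberTheory.EllipticCurves.AnalyticRankWindow
import HarnessLib

/-!
# BirchSwinnertonDyer — rank ≥ 2 observatory: rank-3 census, the NUMERICS-FREE analytic side — `ord_{s=1} L(E,s) ≥ 3` and `L(E,1) = L′(E,1) = L″(E,1) = 0` exactly

HONEST FRAMING: per-curve certified theorems and census instruments; no claim on BSD in rank ≥ 2.

The landed analytic headlines of the rank-3 census (`Rank2ObservatoryRank3CensusAnalytic`,
`Rank2ObservatoryRank3CensusCurves9375` §2) conclude `r_an(E) = rank_ℤ E(ℚ) = 3` for a table row from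
Gross–Zagier–Kolyvagin (`hGZK`, tree fact bsd.S17), the named local-root-number facts `hKD` / `hR`
(Kellock–Dokchitser, Rohrlich; the kernel then evaluates `w(E) = −1`, `Rank3Row.rootNumber_eq_neg_one_of_mem`)
AND the engine-side NUMERICAL input `hL3 : L‴(E,1) ≠ 0`; `Rank3Row.lvalues_eq_zero_kernel` gives
`L(E,1) = L′(E,1) = 0` from `hGZK` alone.  THIS FILE isolates what holds with NO numerical input at all,
i.e. modulo published theorems only (Buhler–Gross–Zagier 1985, p. 479: «Since `L(s)` has odd order, we have
`ord_{s=1} L(s) ≥ 3`», there for `5077a`; here for all 9 487 rows):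
* §0 generic glue over `ℚ`: sign `−1` and three independent points give `3 ≤ r_an`
  (`three_le_analyticRank_of_rootNumber_eq_neg_one` — `≥ 2` by `hGZK`, odd by the sign; the case `r = 3`
  of the tree's `le_analyticRank_of_rootNumber_eq_neg_one`, whose hypotheses `T_k`, `3 ≤ k < r`, are then
  EMPTY), hence `L(E,1) = L′(E,1) = L″(E,1) = 0` (`lvalues012_eq_zero_of_rootNumber_eq_neg_one`; the
  `L″` vanishing is parity and is stated nowhere else in the observatory), `r_an = 3 ∨ 5 ≤ r_an`, and the
  REDUCTION `r_an = 3 ↔ L‴(E,1) ≠ 0` (`analyticRank_eq_three_iff_iteratedDeriv_three_ne_zero`): every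
  EXACT vanishing is a theorem, the one residual input is an OPEN condition (a non-vanishing, certifiable
  by interval arithmetic), never an exact zero;
* §1 the census rows: for every `r ∈ rank3Table` (9 487 curves, `N < 5·10⁵`), under `hGZK`, `hKD`, `hR`
  only — `Rank3Row.hasEntireLFunction_of_mem` and `Rank3Row.odd_analyticRank_of_mem` (these two without
  `hGZK`), `Rank3Row.three_le_analyticRank_of_mem`, `Rank3Row.lvalues012_eq_zero_of_mem`,
  `Rank3Row.analyticRank_eq_three_iff_of_mem`, and over the 9 375 rows of `Rank3KernelRankCensusN9375`
  (`rank_ℤ = 3` hypothesis-free) the BSD inequality `rank_ℤ E(ℚ) ≤ r_an(E)`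
  (`Rank3Row.rank_le_analyticRank_of_mem_rows9375`) and «weak BSD for the row `↔ L‴(E,1) ≠ 0`»
  (`Rank3Row.analyticRank_eq_rank_iff_of_mem_rows9375`; whole table with `hup` for the 112 residual
  rows: `…_of_mem_table112`);
* §2 aggregated: `exists_distinct_curves_three_le_analyticRank_9487` and
  `exists_distinct_curves_rank_le_analyticRank_9375`;
* §3 row `0` (`5077a1`).
Compare the tree's existential floor `SoloBlind.gzk_exists_three_le_analyticRank` (ONE curve, `E₂₆₀₅`, from
`hGZK` alone) and `Curve5077aAnalyticRank.three_le_analyticRank` (5077a, sign as a hypothesis): here the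
same two-line argument runs over the whole census, the sign being the kernel's evaluation of the named
local-root-number tables.  Pure glue BY NAME over landed modules; no definitions, no data, no table
`decide`; sorry-free; no new axioms.  Remaining named inputs, all published theorems: `hGZK` [Darmon 2004, Thm. 3.22], `hKD`
[Kellock–Dokchitser 2023, Thm. 2.3 and §5], `hR` [Rohrlich 1993/1996 via the tree's full local table].

References: J. Buhler, B. Gross, D. Zagier, Math. Comp. 44 (1985) 473–481, §3; J. E. Cremona,
*Algorithms for Modular Elliptic Curves* (2nd ed. 1997) §2.13 (p. 37); H. Darmon, *Rational Points on
Modular Elliptic Curves* (2004) Thm. 3.22; J. H. Silverman, *The Arithmetic of Elliptic Curves* (2nd ed.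
2009) C.16 Thm. 16.3 and remark (p. 451).
-/

-- single-conjunct summit: `Summit.BirchSwinnertonDyer.BirchSwinnertonDyer.…` repeats the name by design
set_option linter.dupNamespace false

namespace Summit.BirchSwinnertonDyer.BirchSwinnertonDyer.Rank2Observatory

open Literature Literature.NumberTheory.EllipticCurves WeierstrassCurve
open Rank3CensusAudit (residualRows112 mem_rows9375_iff rank_eq_three_of_mem_rank3Table112)

/-! ### §0 Generic glue: sign `−1` and three independent points -/

section Generic

variable (W : WeierstrassCurve ℚ) [W.IsElliptic]

/-- **`w(E) = −1` and `rank_ℤ E(ℚ) ≥ 3` give `ord_{s=1} L(E,s) ≥ 3`**, granting Gross–Zagier–Kolyvagin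
(`hGZK`): `ord ≥ 2` by `hGZK` (`two_le_analyticRank_of_two_le_mordellWeilRank`), `ord` odd by the sign
(`odd_analyticRank_of_rootNumber_eq_neg_one`, unconditional) — the argument of the tree's
`Curve5077aAnalyticRank` / the case `r = 3` of `le_analyticRank_of_rootNumber_eq_neg_one`
(`AnalyticRankForcingSchema`, whose hypotheses `T_k`, `3 ≤ k < 3`, are then vacuous), for any curve.
Buhler–Gross–Zagier: «Since `L(s)` has odd order, we have `ord_{s=1} L(s) ≥ 3`».
[cite: BuhlerGrossZagier1985, §3 (p. 479)] [cite: Darmon2004, Thm. 3.22] -/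
theorem three_le_analyticRank_of_rootNumber_eq_neg_one
    (hGZK : rank_eq_analyticRank_of_analyticRank_le_one) (h3 : 3 ≤ W.mordellWeilRank)
    (hw : W.rootNumber = -1) : 3 ≤ W.analyticRank := by
  have h2 : 2 ≤ W.analyticRank :=
    two_le_analyticRank_of_two_le_mordellWeilRank W hGZK (le_trans (by norm_num) h3)
  obtain ⟨k, hk⟩ := odd_analyticRank_of_rootNumber_eq_neg_one hw
  omega

/-- **`L(E,1) = L′(E,1) = L″(E,1) = 0` exactly** for `w(E) = −1`, `rank_ℤ E(ℚ) ≥ 3`, granting `hGZK`: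
every derivative below the analytic rank vanishes (`iteratedDeriv_entireLFunction_one_eq_zero`; `L(E,·)`
is entire for sign `−1` with no modularity input, `hasEntireLFunction_of_rootNumber_eq_neg_one`).
[cite: CremonaAlgorithms1997, §2.13 p. 37] [cite: SilvermanAEC2009, C.16 Thm. 16.3 and remark, p. 451] -/
theorem lvalues012_eq_zero_of_rootNumber_eq_neg_one
    (hGZK : rank_eq_analyticRank_of_analyticRank_le_one) (h3 : 3 ≤ W.mordellWeilRank)
    (hw : W.rootNumber = -1) :
    W.entireLFunction 1 = 0 ∧ deriv W.entireLFunction 1 = 0 ∧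
      iteratedDeriv 2 W.entireLFunction 1 = 0 := by
  have hL : W.HasEntireLFunction := hasEntireLFunction_of_rootNumber_eq_neg_one hw
  have ha := three_le_analyticRank_of_rootNumber_eq_neg_one W hGZK h3 hw
  have h0 := Literature.NumberTheory.EllipticCurves.iteratedDeriv_entireLFunction_one_eq_zero W hL (k := 0) (by omega)
  have h1 := Literature.NumberTheory.EllipticCurves.iteratedDeriv_entireLFunction_one_eq_zero W hL (k := 1) (by omega)
  rw [iteratedDeriv_zero] at h0
  rw [iteratedDeriv_one] at h1
  exact ⟨h0, h1, Literature.NumberTheory.EllipticCurves.iteratedDeriv_entireLFunction_one_eq_zero W hL (k := 2) (by omega)⟩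

/-- For `w(E) = −1`, `rank_ℤ E(ℚ) ≥ 3` and `hGZK`: **`ord_{s=1} L(E,s) = 3` or `≥ 5`** (odd and `≥ 3`).
[cite: SilvermanAEC2009, C.16 Thm. 16.3 and remark, p. 451] [cite: Darmon2004, Thm. 3.22] -/
theorem analyticRank_eq_three_or_five_le_of_rootNumber_eq_neg_one
    (hGZK : rank_eq_analyticRank_of_analyticRank_le_one) (h3 : 3 ≤ W.mordellWeilRank)
    (hw : W.rootNumber = -1) : W.analyticRank = 3 ∨ 5 ≤ W.analyticRank := by
  have ha := three_le_analyticRank_of_rootNumber_eq_neg_one W hGZK h3 hw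
  obtain ⟨k, hk⟩ := odd_analyticRank_of_rootNumber_eq_neg_one hw
  omega

/-- **The reduction.** For `w(E) = −1`, `rank_ℤ E(ℚ) ≥ 3` and `hGZK`: `ord_{s=1} L(E,s) = 3 ↔ L‴(E,1) ≠ 0`
— the leading derivative is non-zero (`iteratedDeriv_analyticRank_ne_zero`), and a non-zero third
derivative caps the order at `3` (`analyticRank_le_of_iteratedDeriv_ne_zero`, Cremona's certification
step) while §0 floors it at `3`.  [cite: CremonaAlgorithms1997, §2.13 p. 37] -/
theorem analyticRank_eq_three_iff_iteratedDeriv_three_ne_zero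
    (hGZK : rank_eq_analyticRank_of_analyticRank_le_one) (h3 : 3 ≤ W.mordellWeilRank)
    (hw : W.rootNumber = -1) : W.analyticRank = 3 ↔ iteratedDeriv 3 W.entireLFunction 1 ≠ 0 := by
  have hL : W.HasEntireLFunction := hasEntireLFunction_of_rootNumber_eq_neg_one hw
  constructor
  · intro h
    rw [← h]
    exact Literature.NumberTheory.EllipticCurves.iteratedDeriv_analyticRank_ne_zero W hL
  · intro h
    exact le_antisymm (Literature.NumberTheory.EllipticCurves.analyticRank_le_of_iteratedDeriv_ne_zero W hL h)
      (three_le_analyticRank_of_rootNumber_eq_neg_one W hGZK h3 hw)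

/-- **Weak BSD for a curve of rank EXACTLY 3 with sign `−1` is ONE open condition**: granting `hGZK`,
`r_an(E) = rank_ℤ E(ℚ) ↔ L‴(E,1) ≠ 0`.  [cite: CremonaAlgorithms1997, §2.13 p. 37] [cite: Darmon2004, Thm. 3.22] -/
theorem analyticRank_eq_rank_iff_iteratedDeriv_three_ne_zero
    (hGZK : rank_eq_analyticRank_of_analyticRank_le_one) (hr : W.mordellWeilRank = 3)
    (hw : W.rootNumber = -1) :
    W.analyticRank = W.mordellWeilRank ↔ iteratedDeriv 3 W.entireLFunction 1 ≠ 0 := by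
  rw [hr]
  exact analyticRank_eq_three_iff_iteratedDeriv_three_ne_zero W hGZK hr.ge hw

/-- The BSD inequality **`rank_ℤ E(ℚ) ≤ r_an(E)`** for a curve of rank exactly `3` with sign `−1`,
granting `hGZK`. [cite: Darmon2004, Thm. 3.22] [cite: BuhlerGrossZagier1985, §3 (p. 479)] -/
theorem rank_le_analyticRank_of_rank_eq_three
    (hGZK : rank_eq_analyticRank_of_analyticRank_le_one) (hr : W.mordellWeilRank = 3)
    (hw : W.rootNumber = -1) : W.mordellWeilRank ≤ W.analyticRank :=
  hr.le.trans (three_le_analyticRank_of_rootNumber_eq_neg_one W hGZK hr.ge hw)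

end Generic

/-! ### §1 The rank-3 census rows (9 487 curves of conductor `< 5·10⁵`) -/

/-- For every row of the rank-3 table, **`L(E,·)` is entire** from the sign alone (`w(E) = −1` by the
kernel's local-root-number evaluation under the named facts `hKD`, `hR`; then the sign-`−1` functional
equation) — no modularity input. [cite: KellockDokchitser2023, Thm. 2.3 and §5]
[cite: SilvermanAEC2009, C.16 Thm. 16.3 and remark, p. 451] -/
theorem Rank3Row.hasEntireLFunction_of_mem {r : Rank3Row} (hr : r ∈ rank3Table)
    (hKD : r.curve.rootNumber_eq_neg_finprod_tableLocalRootNumberAt')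
    (hR : r.curve.rootNumber_eq_neg_finprod_fullTableLocalRootNumberAt) :
    r.curve.HasEntireLFunction := by
  haveI := isElliptic_of_mem hr
  exact hasEntireLFunction_of_rootNumber_eq_neg_one (Rank3Row.rootNumber_eq_neg_one_of_mem hr hKD hR)

/-- For every row of the rank-3 table, **`ord_{s=1} L(E,s)` is odd** (sign `−1` under `hKD`, `hR`;
unconditional parity half). [cite: SilvermanAEC2009, C.16 Thm. 16.3 and remark, p. 451]
[cite: KellockDokchitser2023, Thm. 2.3 and §5] -/
theorem Rank3Row.odd_analyticRank_of_mem {r : Rank3Row} (hr : r ∈ rank3Table)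
    (hKD : r.curve.rootNumber_eq_neg_finprod_tableLocalRootNumberAt')
    (hR : r.curve.rootNumber_eq_neg_finprod_fullTableLocalRootNumberAt) :
    Odd r.curve.analyticRank := by
  haveI := isElliptic_of_mem hr
  exact odd_analyticRank_of_rootNumber_eq_neg_one (Rank3Row.rootNumber_eq_neg_one_of_mem hr hKD hR)

/-- **`ord_{s=1} L(E,s) ≥ 3` for every row of the rank-3 census, NUMERICS-FREE**: the inputs are
Gross–Zagier–Kolyvagin (`hGZK`) and the named local-root-number facts (`hKD`, `hR`); `rank_ℤ ≥ 3` and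
`w(E) = −1` are the kernel's. [cite: BuhlerGrossZagier1985, §3 (p. 479)] [cite: Darmon2004, Thm. 3.22]
[cite: KellockDokchitser2023, Thm. 2.3 and §5] -/
theorem Rank3Row.three_le_analyticRank_of_mem {r : Rank3Row} (hr : r ∈ rank3Table)
    (hGZK : rank_eq_analyticRank_of_analyticRank_le_one)
    (hKD : r.curve.rootNumber_eq_neg_finprod_tableLocalRootNumberAt')
    (hR : r.curve.rootNumber_eq_neg_finprod_fullTableLocalRootNumberAt) :
    3 ≤ r.curve.analyticRank := by
  haveI := isElliptic_of_mem hr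
  exact three_le_analyticRank_of_rootNumber_eq_neg_one r.curve hGZK
    (three_le_mordellWeilRank_of_mem_rank3Table r hr) (Rank3Row.rootNumber_eq_neg_one_of_mem hr hKD hR)

/-- **`L(E,1) = L′(E,1) = L″(E,1) = 0` EXACTLY for every row of the rank-3 census**, from `hGZK`, `hKD`,
`hR` only (the `L″` vanishing is the parity step; `L`, `L′` agree with `Rank3Row.lvalues_eq_zero_kernel`).
[cite: CremonaAlgorithms1997, §2.13 p. 37] [cite: SilvermanAEC2009, C.16 Thm. 16.3 and remark, p. 451] -/
theorem Rank3Row.lvalues012_eq_zero_of_mem {r : Rank3Row} (hr : r ∈ rank3Table)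
    (hGZK : rank_eq_analyticRank_of_analyticRank_le_one)
    (hKD : r.curve.rootNumber_eq_neg_finprod_tableLocalRootNumberAt')
    (hR : r.curve.rootNumber_eq_neg_finprod_fullTableLocalRootNumberAt) :
    r.curve.entireLFunction 1 = 0 ∧ deriv r.curve.entireLFunction 1 = 0 ∧
      iteratedDeriv 2 r.curve.entireLFunction 1 = 0 := by
  haveI := isElliptic_of_mem hr
  exact lvalues012_eq_zero_of_rootNumber_eq_neg_one r.curve hGZK
    (three_le_mordellWeilRank_of_mem_rank3Table r hr) (Rank3Row.rootNumber_eq_neg_one_of_mem hr hKD hR)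

/-- Every derivative of order `< 3` of `L(E,·)` vanishes at `s = 1`, for every row of the rank-3 census
(`hGZK`, `hKD`, `hR`). [cite: CremonaAlgorithms1997, §2.13 p. 37] -/
theorem Rank3Row.iteratedDeriv_eq_zero_of_mem_of_lt_three {r : Rank3Row} (hr : r ∈ rank3Table)
    (hGZK : rank_eq_analyticRank_of_analyticRank_le_one)
    (hKD : r.curve.rootNumber_eq_neg_finprod_tableLocalRootNumberAt')
    (hR : r.curve.rootNumber_eq_neg_finprod_fullTableLocalRootNumberAt) {k : ℕ} (hk : k < 3) :
    iteratedDeriv k r.curve.entireLFunction 1 = 0 := by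
  haveI := isElliptic_of_mem hr
  exact Literature.NumberTheory.EllipticCurves.iteratedDeriv_entireLFunction_one_eq_zero r.curve (Rank3Row.hasEntireLFunction_of_mem hr hKD hR)
    (lt_of_lt_of_le hk (Rank3Row.three_le_analyticRank_of_mem hr hGZK hKD hR))

/-- For every row of the rank-3 census: **`ord_{s=1} L(E,s) = 3` or `≥ 5`** (`hGZK`, `hKD`, `hR`).
[cite: SilvermanAEC2009, C.16 Thm. 16.3 and remark, p. 451] [cite: Darmon2004, Thm. 3.22] -/
theorem Rank3Row.analyticRank_eq_three_or_five_le_of_mem {r : Rank3Row} (hr : r ∈ rank3Table)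
    (hGZK : rank_eq_analyticRank_of_analyticRank_le_one)
    (hKD : r.curve.rootNumber_eq_neg_finprod_tableLocalRootNumberAt')
    (hR : r.curve.rootNumber_eq_neg_finprod_fullTableLocalRootNumberAt) :
    r.curve.analyticRank = 3 ∨ 5 ≤ r.curve.analyticRank := by
  haveI := isElliptic_of_mem hr
  exact analyticRank_eq_three_or_five_le_of_rootNumber_eq_neg_one r.curve hGZK
    (three_le_mordellWeilRank_of_mem_rank3Table r hr) (Rank3Row.rootNumber_eq_neg_one_of_mem hr hKD hR)

/-- **The reduction, per row**: for every row of the rank-3 census, `ord_{s=1} L(E,s) = 3 ↔ L‴(E,1) ≠ 0`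
(`hGZK`, `hKD`, `hR`) — the numerical input of the landed analytic headlines is EXACTLY what is left.
[cite: CremonaAlgorithms1997, §2.13 p. 37] [cite: Darmon2004, Thm. 3.22] -/
theorem Rank3Row.analyticRank_eq_three_iff_of_mem {r : Rank3Row} (hr : r ∈ rank3Table)
    (hGZK : rank_eq_analyticRank_of_analyticRank_le_one)
    (hKD : r.curve.rootNumber_eq_neg_finprod_tableLocalRootNumberAt')
    (hR : r.curve.rootNumber_eq_neg_finprod_fullTableLocalRootNumberAt) :
    r.curve.analyticRank = 3 ↔ iteratedDeriv 3 r.curve.entireLFunction 1 ≠ 0 := by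
  haveI := isElliptic_of_mem hr
  exact analyticRank_eq_three_iff_iteratedDeriv_three_ne_zero r.curve hGZK
    (three_le_mordellWeilRank_of_mem_rank3Table r hr) (Rank3Row.rootNumber_eq_neg_one_of_mem hr hKD hR)

/-- **BSD inequality `rank_ℤ E(ℚ) ≤ r_an(E)` over GRAND census N9375** (9 375 rows, `rank_ℤ = 3`
hypothesis-free), from `hGZK`, `hKD`, `hR` only. [cite: Darmon2004, Thm. 3.22]
[cite: BuhlerGrossZagier1985, §3 (p. 479)] [cite: Cassels1991LecturesEllipticCurves, §15] -/
theorem Rank3Row.rank_le_analyticRank_of_mem_rows9375 {r : Rank3Row}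
    (hr : r ∈ Rank3KernelRankCensusN9375.rows) (hGZK : rank_eq_analyticRank_of_analyticRank_le_one)
    (hKD : r.curve.rootNumber_eq_neg_finprod_tableLocalRootNumberAt')
    (hR : r.curve.rootNumber_eq_neg_finprod_fullTableLocalRootNumberAt) :
    r.curve.mordellWeilRank ≤ r.curve.analyticRank :=
  (Rank3KernelRankCensusN9375.rank_eq_three r hr).le.trans
    (Rank3Row.three_le_analyticRank_of_mem (mem_rows9375_iff.1 hr).1 hGZK hKD hR)

/-- **Weak BSD for a row of GRAND census N9375 is ONE open condition**: `r_an(E) = rank_ℤ E(ℚ) ↔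
L‴(E,1) ≠ 0`, from `hGZK`, `hKD`, `hR` (the rank `= 3` is the kernel's).  [cite: CremonaAlgorithms1997, §2.13 p. 37]
[cite: Darmon2004, Thm. 3.22] [cite: Cassels1991LecturesEllipticCurves, §15] -/
theorem Rank3Row.analyticRank_eq_rank_iff_of_mem_rows9375 {r : Rank3Row}
    (hr : r ∈ Rank3KernelRankCensusN9375.rows) (hGZK : rank_eq_analyticRank_of_analyticRank_le_one)
    (hKD : r.curve.rootNumber_eq_neg_finprod_tableLocalRootNumberAt')
    (hR : r.curve.rootNumber_eq_neg_finprod_fullTableLocalRootNumberAt) :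
    r.curve.analyticRank = r.curve.mordellWeilRank ↔ iteratedDeriv 3 r.curve.entireLFunction 1 ≠ 0 := by
  rw [Rank3KernelRankCensusN9375.rank_eq_three r hr]
  exact Rank3Row.analyticRank_eq_three_iff_of_mem (mem_rows9375_iff.1 hr).1 hGZK hKD hR

/-- Whole-table form of the reduction: for every row of the rank-3 census, granting the 2-descent bound
`rank_ℤ ≤ 3` ONLY if the row is one of the 112 residual rows, `r_an(E) = rank_ℤ E(ℚ) ↔ L‴(E,1) ≠ 0`
(`hGZK`, `hKD`, `hR`). [cite: CremonaAlgorithms1997, §2.13 p. 37] [cite: Darmon2004, Thm. 3.22] -/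
theorem Rank3Row.analyticRank_eq_rank_iff_of_mem_table112 {r : Rank3Row} (hr : r ∈ rank3Table)
    (hup : r ∈ residualRows112 → r.curve.mordellWeilRank ≤ 3)
    (hGZK : rank_eq_analyticRank_of_analyticRank_le_one)
    (hKD : r.curve.rootNumber_eq_neg_finprod_tableLocalRootNumberAt')
    (hR : r.curve.rootNumber_eq_neg_finprod_fullTableLocalRootNumberAt) :
    r.curve.analyticRank = r.curve.mordellWeilRank ↔ iteratedDeriv 3 r.curve.entireLFunction 1 ≠ 0 := by
  rw [rank_eq_three_of_mem_rank3Table112 hr hup]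
  exact Rank3Row.analyticRank_eq_three_iff_of_mem hr hGZK hKD hR

/-! ### §2 Aggregated statements -/

/-- **HEADLINE (numerics-free analytic side, whole table).** Granting Gross–Zagier–Kolyvagin and the named
local-root-number facts for the curves of the table, there are **9 487 pairwise DISTINCT elliptic curves
over `ℚ` of conductor `< 5·10⁵` with `rank_ℤ E(ℚ) ≥ 3`, `ord_{s=1} L(E,s) ≥ 3` and
`L(E,1) = L′(E,1) = L″(E,1) = 0` exactly** — no numerical input. [cite: BuhlerGrossZagier1985, §3 (p. 479)]
[cite: Darmon2004, Thm. 3.22] [cite: CremonaAlgorithms1997, §2.13 and Tables] -/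
theorem exists_distinct_curves_three_le_analyticRank_9487
    (hGZK : rank_eq_analyticRank_of_analyticRank_le_one)
    (hKD : ∀ r ∈ rank3Table, r.curve.rootNumber_eq_neg_finprod_tableLocalRootNumberAt')
    (hR : ∀ r ∈ rank3Table, r.curve.rootNumber_eq_neg_finprod_fullTableLocalRootNumberAt) :
    ∃ l : List (WeierstrassCurve ℚ), l.Nodup ∧ l.length = 9487 ∧
      ∀ E ∈ l, E.IsElliptic ∧ E.conductorNorm ℤ < 500000 ∧ 3 ≤ E.mordellWeilRank ∧ 3 ≤ E.analyticRank ∧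
        E.entireLFunction 1 = 0 ∧ deriv E.entireLFunction 1 = 0 ∧ iteratedDeriv 2 E.entireLFunction 1 = 0 := by
  refine ⟨rank3Table.map Rank3Row.curve, rank3Table_curves_nodup,
    by rw [List.length_map, rank3Table_length], ?_⟩
  intro E hE
  obtain ⟨r, hr, rfl⟩ := List.mem_map.1 hE
  exact ⟨isElliptic_of_mem hr, Rank3Row.conductorNorm_lt_of_mem hr,
    three_le_mordellWeilRank_of_mem_rank3Table r hr,
    Rank3Row.three_le_analyticRank_of_mem hr hGZK (hKD r hr) (hR r hr),
    Rank3Row.lvalues012_eq_zero_of_mem hr hGZK (hKD r hr) (hR r hr)⟩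

/-- **HEADLINE (GRAND census N9375).** Granting `hGZK` and the named local-root-number facts, there are
**9 375 pairwise distinct elliptic curves over `ℚ` of conductor `< 5·10⁵` with `rank_ℤ E(ℚ) = 3`
(hypothesis-free), `rank_ℤ E(ℚ) ≤ ord_{s=1} L(E,s)`, and weak BSD for the curve EQUIVALENT to the single
open condition `L‴(E,1) ≠ 0`**. [cite: Darmon2004, Thm. 3.22] [cite: CremonaAlgorithms1997, §2.13 and Tables]
[cite: Cassels1991LecturesEllipticCurves, §15] -/
theorem exists_distinct_curves_rank_le_analyticRank_9375
    (hGZK : rank_eq_analyticRank_of_analyticRank_le_one)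
    (hKD : ∀ r ∈ rank3Table, r.curve.rootNumber_eq_neg_finprod_tableLocalRootNumberAt')
    (hR : ∀ r ∈ rank3Table, r.curve.rootNumber_eq_neg_finprod_fullTableLocalRootNumberAt) :
    ∃ l : List (WeierstrassCurve ℚ), l.Nodup ∧ l.length = 9375 ∧
      ∀ E ∈ l, E.IsElliptic ∧ E.conductorNorm ℤ < 500000 ∧ E.mordellWeilRank = 3 ∧
        E.mordellWeilRank ≤ E.analyticRank ∧
        (E.analyticRank = E.mordellWeilRank ↔ iteratedDeriv 3 E.entireLFunction 1 ≠ 0) := by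
  refine ⟨Rank3KernelRankCensusN9375.rows.map Rank3Row.curve, Rank3Joins112.rows9375_curves_nodup,
    by rw [List.length_map, Rank3KernelRankCensusN9375.rows_length], ?_⟩
  intro E hE
  obtain ⟨r, hr, rfl⟩ := List.mem_map.1 hE
  have hrt : r ∈ rank3Table := (mem_rows9375_iff.1 hr).1
  exact ⟨isElliptic_of_mem hrt, Rank3Row.conductorNorm_lt_of_mem hrt,
    Rank3KernelRankCensusN9375.rank_eq_three r hr,
    Rank3Row.rank_le_analyticRank_of_mem_rows9375 hr hGZK (hKD r hrt) (hR r hrt),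
    Rank3Row.analyticRank_eq_rank_iff_of_mem_rows9375 hr hGZK (hKD r hrt) (hR r hrt)⟩

/-! ### §3 Row `0`: `5077a1` -/

/-- Row `0` (`5077a1`, `[0,0,1,-7,6]`): `ord_{s=1} L(E,s) ≥ 3` and `L″(E,1) = 0` from `hGZK`, `hKD`, `hR`
— Buhler–Gross–Zagier's triple zero with no real-number computation (their (14),
`lim L(s)/(s−1)³ ≈ 1.7318…`, is exactly the residual open condition of
`Rank3Row.analyticRank_eq_three_iff_of_mem`). [cite: BuhlerGrossZagier1985, §3 (p. 479) and §4 eq. (14)] -/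
theorem three_le_analyticRank_5077a1 (hGZK : rank_eq_analyticRank_of_analyticRank_le_one)
    (hKD : (rank3Table[0]'(by rw [rank3Table_length]; decide)).curve.rootNumber_eq_neg_finprod_tableLocalRootNumberAt')
    (hR : (rank3Table[0]'(by rw [rank3Table_length]; decide)).curve.rootNumber_eq_neg_finprod_fullTableLocalRootNumberAt) :
    3 ≤ (rank3Table[0]'(by rw [rank3Table_length]; decide)).curve.analyticRank ∧
      iteratedDeriv 2 (rank3Table[0]'(by rw [rank3Table_length]; decide)).curve.entireLFunction 1 = 0 :=
  ⟨Rank3Row.three_le_analyticRank_of_mem (List.getElem_mem _) hGZK hKD hR,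
    (Rank3Row.lvalues012_eq_zero_of_mem (List.getElem_mem _) hGZK hKD hR).2.2⟩

end Summit.BirchSwinnertonDyer.BirchSwinnertonDyer.Rank2Observatory
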